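import Summits.QuantumAdvantage.QuantumAdvantage.Theorems.CharDialSubCharJunta
import Mathlib.Algebra.MvPolynomial.CommRing
import Mathlib.Algebra.MvPolynomial.Eval
import Mathlib.Algebra.MvPolynomial.Degrees
import Mathlib.RingTheory.Polynomial.Pochhammer
import Mathlib.Data.Nat.Factorial.Basic
import HarnessLib

/-!
# TwoBlockMoebius — block weights, two-block Möbius symmetry, and the binomial basis of `𝔽_p[X,Y]`

(Part 1 of 2; the structure theorem is `TwoBlockFrob.lean`.)

(decomp-qadv-lens-6 g8.)  `SubChar.twoBlock_frob`: if `f : {0,1}ⁿ → {0,1}` depends only on the pair of block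
weights `(wt_A u, wt_B u)` for two disjoint blocks `A, B` with `|A|, |B| ≥ p − 1`, and `f` has `𝔽_p`-degree
`≤ p − 1`, then `f u = h (a·wt_A u + b·wt_B u mod p)` for some `a b : 𝔽_p`, `h : 𝔽_p → Bool` — the CharDial node's
`FrobStructureLaw` shape with `J = ∅` and a coefficient vector constant on each block.  This is the cube-side form of
the census sector `(p, 2)` for ALL block sizes: the two block weights do NOT mix except through ONE linear form.

Proof.  (1) Möbius coefficients of a two-block-symmetric function depend only on the intersection sizes
(`moeb_twoBlock`, a double binomial sum `γ`); (2) the polynomial `P = Σ_{i+j ≤ p−1} γ(i,j)·C(X,i)·C(Y,j)` on `𝔽_p²`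
(binomial basis `binomP`, total degree `≤ p − 1`; the coefficients with `i + j ≥ p` vanish by the degree test
`moeb_eq_zero_of_mem_lowDeg`) interpolates the weight profile on `[0,p)²` (`sum_moeb_powerset` + Vandermonde-free
double counting `sum_powerset_twoBlock`); (3) `FrobPlane.frobPlane` gives `profile(s,t) = h(a s + b t)` on `𝔽_p²`;
(4) `block_periodic` makes the profile `p`-periodic in each block weight, so the formula holds for all weights.
-/

namespace Summit.QuantumAdvantage.AdviceFreeQNC0

namespace SubChar

open Finset MvPolynomial
open Literature.Computability.MetaComplexity Literature.Computability.MetaComplexity.Smolensky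
open SubLog

variable {n : ℕ}

/-! ### Block weights -/

/-- Weight of `u` inside the block `A`. -/
def bw (A : Finset (Fin n)) (u : Fin n → Bool) : ℕ := (A.filter fun i => u i = true).card

/-- CharDial sub-characteristic helper `bw_le` (lens-6 g8 LAND package; see the module docstring). -/
theorem bw_le (A : Finset (Fin n)) (u : Fin n → Bool) : bw A u ≤ A.card := card_filter_le _ _

/-- CharDial sub-characteristic helper `bw_vert` (lens-6 g8 LAND package; see the module docstring). -/
theorem bw_vert (A T : Finset (Fin n)) : bw A (vert T) = (T ∩ A).card := by
  classical
  unfold bw vert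
  rw [inter_comm]
  congr 1; ext i; simp [mem_inter]

/-- CharDial sub-characteristic helper `bw_setOn` (lens-6 g8 LAND package; see the module docstring). -/
theorem bw_setOn {A T : Finset (Fin n)} {u : Fin n → Bool} (hT : ∀ i ∈ T, u i = false) :
    bw A (setOn T u) = bw A u + (T ∩ A).card := by
  classical
  unfold bw
  have hset : (A.filter fun i => setOn T u i = true) = (A.filter fun i => u i = true) ∪ (T ∩ A) := by
    ext i
    simp only [mem_filter, mem_union, mem_inter, setOn]
    by_cases hi : i ∈ T
    · simp [hi, hT i hi]
    · simp [hi]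
  rw [hset, card_union_of_disjoint]
  rw [Finset.disjoint_left]
  intro i hi hiT
  simp only [mem_filter] at hi
  rw [hT i (mem_inter.1 hiT).1] at hi
  exact Bool.false_ne_true hi.2

/-- CharDial sub-characteristic helper `natCast_bw` (lens-6 g8 LAND package; see the module docstring). -/
theorem natCast_bw (R : Type*) [AddCommMonoidWithOne R] (A : Finset (Fin n)) (u : Fin n → Bool) :
    (bw A u : R) = ∑ i ∈ A, (if u i then (1 : R) else 0) := by
  classical
  unfold bw
  rw [Finset.natCast_card_filter]

/-! ### Double counting over the powerset of a two-block set -/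

/-- `Σ_{T ⊆ S} G |T∩A| |T∩B| = Σ_i C(|S∩A|,i) Σ_j C(|S∩B|,j) G i j` for `S ⊆ A ∪ B`, `A, B` disjoint. -/
theorem sum_powerset_twoBlock {R : Type*} [AddCommMonoid R] {A B S : Finset (Fin n)} (hAB : Disjoint A B)
    (hS : S ⊆ A ∪ B) (G : ℕ → ℕ → R) :
    ∑ T ∈ S.powerset, G (T ∩ A).card (T ∩ B).card =
      ∑ i ∈ range ((S ∩ A).card + 1), (S ∩ A).card.choose i •
        ∑ j ∈ range ((S ∩ B).card + 1), (S ∩ B).card.choose j • G i j := by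
  classical
  have step1 : ∑ T ∈ S.powerset, G (T ∩ A).card (T ∩ B).card =
      ∑ q ∈ (S ∩ A).powerset ×ˢ (S ∩ B).powerset, G q.1.card q.2.card := by
    refine Finset.sum_nbij' (fun T => (T ∩ A, T ∩ B)) (fun q => q.1 ∪ q.2) ?_ ?_ ?_ ?_ ?_
    · intro T hT
      rw [mem_powerset] at hT
      simp only [mem_product, mem_powerset]
      exact ⟨inter_subset_inter_right hT, inter_subset_inter_right hT⟩
    · intro q hq
      simp only [mem_product, mem_powerset] at hq
      rw [mem_powerset]
      exact union_subset (hq.1.trans inter_subset_left) (hq.2.trans inter_subset_left)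
    · intro T hT
      rw [mem_powerset] at hT
      show T ∩ A ∪ T ∩ B = T
      rw [← inter_union_distrib_left]
      exact inter_eq_left.2 (hT.trans hS)
    · intro q hq
      simp only [mem_product, mem_powerset] at hq
      have h1 : q.1 ⊆ A := hq.1.trans inter_subset_right
      have h2 : q.2 ⊆ B := hq.2.trans inter_subset_right
      have e1 : (q.1 ∪ q.2) ∩ A = q.1 := by
        rw [union_inter_distrib_right, inter_eq_left.2 h1]
        have : q.2 ∩ A = ∅ := disjoint_iff_inter_eq_empty.1 (hAB.symm.mono_left h2)
        rw [this, union_empty]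
      have e2 : (q.1 ∪ q.2) ∩ B = q.2 := by
        rw [union_inter_distrib_right, inter_eq_left.2 h2]
        have : q.1 ∩ B = ∅ := disjoint_iff_inter_eq_empty.1 (hAB.mono_left h1)
        rw [this, empty_union]
      exact Prod.ext e1 e2
    · intro T _; rfl
  rw [step1, Finset.sum_product]
  rw [Finset.sum_powerset_apply_card (fun i => ∑ Y ∈ (S ∩ B).powerset, G i Y.card)]
  refine Finset.sum_congr rfl fun i _ => ?_
  rw [Finset.sum_powerset_apply_card (fun j => G i j)]

/-- For `T ⊆ A ∪ B` with `A, B` disjoint, `|T| = |T ∩ A| + |T ∩ B|`. -/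
theorem card_eq_twoBlock {A B T : Finset (Fin n)} (hAB : Disjoint A B) (hT : T ⊆ A ∪ B) :
    T.card = (T ∩ A).card + (T ∩ B).card := by
  classical
  rw [← card_union_of_disjoint (disjoint_of_subset_left inter_subset_right
    (disjoint_of_subset_right inter_subset_right hAB))]
  congr 1
  rw [← inter_union_distrib_left]
  exact (inter_eq_left.2 hT).symm

/-! ### Möbius coefficients of a two-block-symmetric function -/

/-- The double binomial transform of a profile: `γ(i,j) = Σ_{i'≤i, j'≤j} C(i,i') C(j,j') (−1)^{i+j−i'−j'} Φ̂(i',j')`. -/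
def gam {R : Type*} [CommRing R] (Φh : ℕ → ℕ → R) (i j : ℕ) : R :=
  ∑ i' ∈ range (i + 1), i.choose i' • ∑ j' ∈ range (j + 1), j.choose j' • ((-1 : R) ^ (i + j - (i' + j')) * Φh i' j')

/-- Möbius coefficients of a function of the two block weights depend only on the intersection sizes. -/
theorem moeb_twoBlock {R : Type*} [CommRing R] {A B : Finset (Fin n)} (hAB : Disjoint A B)
    (g : (Fin n → Bool) → R) (Φh : ℕ → ℕ → R) (hg : ∀ T ⊆ A ∪ B, g (vert T) = Φh (T ∩ A).card (T ∩ B).card)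
    {S : Finset (Fin n)} (hS : S ⊆ A ∪ B) :
    moeb g S = gam Φh (S ∩ A).card (S ∩ B).card := by
  classical
  unfold moeb gam
  have h1 : ∀ T ∈ S.powerset, (-1 : R) ^ (S.card - T.card) * g (vert T) =
      (fun i' j' => (-1 : R) ^ ((S ∩ A).card + (S ∩ B).card - (i' + j')) * Φh i' j') (T ∩ A).card (T ∩ B).card := by
    intro T hT
    have hT' : T ⊆ A ∪ B := (mem_powerset.1 hT).trans hS
    simp only
    rw [hg T hT', card_eq_twoBlock hAB hS, card_eq_twoBlock hAB hT']
  rw [Finset.sum_congr rfl h1,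
    sum_powerset_twoBlock hAB hS (fun i' j' => (-1 : R) ^ ((S ∩ A).card + (S ∩ B).card - (i' + j')) * Φh i' j')]

end SubChar

/-! ### The binomial basis of `𝔽_p[X,Y]` -/

namespace FrobPlane

open MvPolynomial Finset Polynomial

variable {p : ℕ} [hp : Fact p.Prime]

/-- `C(X_k, i) = (i!)⁻¹ · Π_{m<i} (X_k − m)`. -/
noncomputable def binomP (k : Fin 2) (i : ℕ) : MvPolynomial (Fin 2) (ZMod p) :=
  MvPolynomial.C ((i.factorial : ZMod p)⁻¹) * ∏ m ∈ range i, (MvPolynomial.X k - MvPolynomial.C (m : ZMod p))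

/-- CharDial sub-characteristic helper `totalDegree_binomP` (lens-6 g8 LAND package; see the module docstring). -/
theorem totalDegree_binomP (k : Fin 2) (i : ℕ) : (binomP (p := p) k i).totalDegree ≤ i := by
  unfold binomP
  refine (totalDegree_mul _ _).trans ?_
  rw [totalDegree_C, zero_add]
  refine (totalDegree_finsetProd _ _).trans ?_
  have : ∀ m ∈ range i, (MvPolynomial.X k - MvPolynomial.C (m : ZMod p) : MvPolynomial (Fin 2) (ZMod p)).totalDegree ≤ 1 := by
    intro m _
    refine (totalDegree_sub _ _).trans (max_le ?_ ?_)
    · simp [totalDegree_X]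
    · rw [totalDegree_C]; exact Nat.zero_le _
  exact (Finset.sum_le_sum this).trans (by simp)

/-- CharDial sub-characteristic helper `prod_range_sub_eq_descPochhammer` (lens-6 g8 LAND package; see the module docstring). -/
theorem prod_range_sub_eq_descPochhammer {R : Type*} [CommRing R] (x : R) (i : ℕ) :
    ∏ m ∈ range i, (x - (m : R)) = (descPochhammer R i).eval x := by
  induction i with
  | zero => simp
  | succ i ih => rw [prod_range_succ, ih, descPochhammer_succ_eval]

/-- CharDial sub-characteristic helper `eval_binomP` (lens-6 g8 LAND package; see the module docstring). -/
theorem eval_binomP (x : Fin 2 → ZMod p) (k : Fin 2) {i : ℕ} (hi : i < p) :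
    MvPolynomial.eval x (binomP k i) = (((x k).val.choose i : ℕ) : ZMod p) := by
  unfold binomP
  rw [MvPolynomial.eval_mul, MvPolynomial.eval_C, MvPolynomial.eval_prod]
  have h1 : ∏ m ∈ range i, MvPolynomial.eval x (MvPolynomial.X k - MvPolynomial.C (m : ZMod p))
      = ∏ m ∈ range i, (x k - (m : ZMod p)) := by
    refine Finset.prod_congr rfl fun m _ => ?_
    rw [MvPolynomial.eval_sub, MvPolynomial.eval_X, MvPolynomial.eval_C]
  rw [h1]
  conv_lhs => rw [← ZMod.natCast_zmod_val (x k)]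
  rw [prod_range_sub_eq_descPochhammer, descPochhammer_eval_eq_descFactorial,
    Nat.descFactorial_eq_factorial_mul_choose, Nat.cast_mul]
  have hfact : ((i.factorial : ℕ) : ZMod p) ≠ 0 := by
    rw [Ne, ZMod.natCast_eq_zero_iff]
    exact fun h => absurd ((hp.out.dvd_factorial).1 h) (by omega)
  rw [← mul_assoc, inv_mul_cancel₀ hfact, one_mul]

end FrobPlane

end Summit.QuantumAdvantage.AdviceFreeQNC0
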